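import Mathlib
import Literature.Barriers.ValiantsHypothesis.AlgebraicNaturalProofs
import Summits.ValiantsHypothesis.ValiantsHypothesis.Theorems.BarrierLeverSuccinctHittingSetsForVPStubAffineFormIrreducible
import Summits.ValiantsHypothesis.ValiantsHypothesis.Theorems.BarrierLeverSuccinctHittingSetsForVPStubSps2NotAnnihilated
import Summits.ValiantsHypothesis.ValiantsHypothesis.Theorems.BarrierLeverSuccinctHittingSetsForVPStubSps2Hit
import HarnessLib

/-!
# Crux `BarrierLever.SuccinctHittingSetsForVP` (stmt-ValiantsHypothesis-14610), line `registered` —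
`ΣΠΣ(2)` DISTINGUISHERS ARE HIT (lead assembly of wave 7, unconditional)

**What is proved (unconditional; it does NOT close the item — the open heart `stub_superDense` is
FSV18 Question 6 itself).** In Forbes–Shpilka–Volk's framework over `ℂ` (tree regime `d = n`,
coefficient variables `c_μ`, `μ ∈ degLEMonomials n`, simple class `SmallCircuits ℂ n b`):

* `isSuccinctHittingSet_sps2` / `stub_sps2` : for every `n ≥ 8` the coefficient vectors of
  `SmallCircuits ℂ n 9` hit every nonzero distinguisher of the form
  `D = a ∏_{i<p} ℓ_i + b ∏_{j<q} ℓ'_j` with NON-CONSTANT AFFINE FORMS `ℓ_i, ℓ'_j` of the coefficient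
  variables (`ΣΠΣ` circuits of top fan-in two; any number of factors, any degree, any size — the
  forms are dense, so these are neither sparse, nor of low partial-derivative dimension, nor
  polynomials in few linear forms). Special members: every product of affine forms (`ΠΣ`, `b = 0`),
  every "`2 × 2` determinant of affine forms" `ℓ₁ ℓ₂ - ℓ₃ ℓ₄`, every binomial in affine forms.
* `levelOne_sps2` : the `∃ b n₀` form at level one (`b = 9`, `n₀ = 8`).
* `not_isNaturalProof_sps2` : no such `D` is an algebraically natural proof against
  `SmallCircuits ℂ n b`, `b ≥ 9`, `n ≥ 8`, for any ambient class `𝒟`.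

**Proof (the three registered wave-7 stubs).** The TWO-SEED SEPARABLE GENERATOR
`Γ₂ : c_μ ↦ y₀ s₀^μ + y₁ s₁^μ` (seeds `y : Fin 2`, `s : Fin 2 × Fin n`) takes all its values in
`coeff(SmallCircuits ℂ n 9)` (`stub_sps2Hit`, p163305: `y₀ Λ_{s₀} + y₁ Λ_{s₁}` with the rank-one circuits
`Λ_s = Σ_{|m| ≤ n} s^m x^m` of `stub_separableCoeff`), maps a non-constant affine form
`ℓ = a₀ + Σ a_μ c_μ` to `a₀ + y₀ P_ℓ(s₀) + y₁ P_ℓ(s₁)`, `P_ℓ = Σ a_μ s^μ ≠ 0`, which is IRREDUCIBLE in the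
UFD `ℂ[y, s]` (`stub_affineFormIrreducible`, p163609) and determines `ℓ`; by unique factorisation a
relation `a ∏ (ℓ_i ∘ Γ₂) = -b ∏ (ℓ'_j ∘ Γ₂)` matches the factors up to nonzero constants, forcing
`∏ ℓ_i = κ ∏ ℓ'_j` and then `D = 0` (`stub_sps2NotAnnihilated`, p163442) — so no nonzero `ΣΠΣ(2)`
distinguisher annihilates `Γ₂`, and the generator principle (FSV §3) hits it. This is the `k = 2`
case of rank-bound identity testing for `ΣΠΣ(k)` (Dvir–Shpilka 2007, Kayal–Saraf 2009,
Saxena–Seshadhri 2011), which needs no rank bound; `k ≥ 3` would need the rank bounds and is not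
attempted. Axioms: `propext`, `Classical.choice`, `Quot.sound`.

References: [ForbesShpilkaVolk2018] §3 (generators), Thm. 9, Question 6; Z. Dvir, A. Shpilka,
SIAM J. Comput. 36 (2007) (rank of `ΣΠΣ(k)` identities); N. Saxena, C. Seshadhri, STOC 2011
("blackbox identity testing for bounded top fanin depth-3 circuits: the field doesn't matter").
-/

-- layout Summits/ValiantsHypothesis/ValiantsHypothesis forces the duplicated namespace component
set_option linter.dupNamespace false

namespace Summit.ValiantsHypothesis.ValiantsHypothesis.Theorems.BarrierLever.SuccinctHittingSetsForVP

open Literature.Barriers.ValiantsHypothesis Literature.Computability.AlgebraicComplexity MvPolynomial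

/-- **`ΣΠΣ(2)` distinguishers are hit** (wave 7 assembled, unconditional): for `n ≥ 8`,
`SmallCircuits ℂ n 9` hits every nonzero `a ∏ ℓ_i + b ∏ ℓ'_j` with affine forms `ℓ_i, ℓ'_j` of total
degree `1`. [cite: ForbesShpilkaVolk2018, §3 and Question 6] -/
theorem isSuccinctHittingSet_sps2 {n : ℕ} (hn : 8 ≤ n) :
    IsSuccinctHittingSet (degLEMonomials n) (SmallCircuits ℂ n 9)
      {D | ∃ (p q : ℕ) (a b : ℂ) (ℓ : Fin p → MvPolynomial (degLEMonomials n) ℂ)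
        (ℓ' : Fin q → MvPolynomial (degLEMonomials n) ℂ),
        (∀ i, (ℓ i).totalDegree = 1) ∧ (∀ j, (ℓ' j).totalDegree = 1) ∧
        D = C a * ∏ i, ℓ i + C b * ∏ j, ℓ' j} :=
  stub_sps2Hit (stub_sps2NotAnnihilated stub_affineFormIrreducible) n hn

/-- **Registered stub `stub_sps2`** (crux stmt-ValiantsHypothesis-14610, line `registered`; lead
assembly of wave 7): verbatim `isSuccinctHittingSet_sps2` for all `n ≥ 8`.
[cite: ForbesShpilkaVolk2018, §3 and Question 6] -/
theorem stub_sps2 :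
    ∀ n : ℕ, 8 ≤ n →
      IsSuccinctHittingSet (degLEMonomials n) (SmallCircuits ℂ n 9)
        {D | ∃ (p q : ℕ) (a b : ℂ) (ℓ : Fin p → MvPolynomial (degLEMonomials n) ℂ)
          (ℓ' : Fin q → MvPolynomial (degLEMonomials n) ℂ),
          (∀ i, (ℓ i).totalDegree = 1) ∧ (∀ j, (ℓ' j).totalDegree = 1) ∧
          D = C a * ∏ i, ℓ i + C b * ∏ j, ℓ' j} :=
  fun _ hn => isSuccinctHittingSet_sps2 hn

/-- **Level-one form**: FSV Question 6 at level one HOLDS against the level-one `ΣΠΣ(2)`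
distinguishers (`b = 9`, `n₀ = 8`) — a settled part of the open stub `stub_superDense`.
[cite: ForbesShpilkaVolk2018, Question 6] -/
theorem levelOne_sps2 :
    ∃ b n₀ : ℕ, ∀ n : ℕ, n₀ ≤ n →
      IsSuccinctHittingSet (degLEMonomials n) (SmallCircuits ℂ n b)
        (Distinguishers ℂ n 1 ∩
          {D | ∃ (p q : ℕ) (a b : ℂ) (ℓ : Fin p → MvPolynomial (degLEMonomials n) ℂ)
            (ℓ' : Fin q → MvPolynomial (degLEMonomials n) ℂ),
            (∀ i, (ℓ i).totalDegree = 1) ∧ (∀ j, (ℓ' j).totalDegree = 1) ∧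
            D = C a * ∏ i, ℓ i + C b * ∏ j, ℓ' j}) :=
  ⟨9, 8, fun _ hn => (isSuccinctHittingSet_sps2 hn).mono le_rfl Set.inter_subset_right⟩

/-- **No `ΣΠΣ(2)` natural proofs against `VP` in regime `d = n`**: for `n ≥ 8`, `b ≥ 9`, any class `𝒟`
and any non-constant affine forms `ℓ_i, ℓ'_j`, the polynomial `a ∏ ℓ_i + b' ∏ ℓ'_j` is NOT an
algebraically natural proof against `SmallCircuits ℂ n b` (FSV Def. 1): if nonzero it is hit.
[cite: ForbesShpilkaVolk2018, Def. 1 and Thm. 4] -/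
theorem not_isNaturalProof_sps2 {n b : ℕ} (hn : 8 ≤ n) (hb : 9 ≤ b)
    (𝒟 : Set (MvPolynomial (degLEMonomials n) ℂ)) {p q : ℕ} (a b' : ℂ)
    (ℓ : Fin p → MvPolynomial (degLEMonomials n) ℂ) (ℓ' : Fin q → MvPolynomial (degLEMonomials n) ℂ)
    (hℓ : ∀ i, (ℓ i).totalDegree = 1) (hℓ' : ∀ j, (ℓ' j).totalDegree = 1) :
    ¬ IsNaturalProof (degLEMonomials n) (SmallCircuits ℂ n b) 𝒟
      (C a * ∏ i, ℓ i + C b' * ∏ j, ℓ' j) := by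
  rintro ⟨-, hD0, hvan⟩
  obtain ⟨f, hf, hne⟩ :=
    isSuccinctHittingSet_sps2 hn _ ⟨p, q, a, b', ℓ, ℓ', hℓ, hℓ', rfl⟩ hD0
  exact hne (hvan f (smallCircuits_mono ℂ hb (by omega) hf))

/-- **Products of affine forms (`ΠΣ`, dense) are hit**: for `n ≥ 8`, `SmallCircuits ℂ n 9` hits every
nonzero `a ∏ ℓ_i` with non-constant affine forms `ℓ_i` (the case `b = 0`, `q = 0` of
`isSuccinctHittingSet_sps2`). [cite: ForbesShpilkaVolk2018, Thm. 9 and Question 6] -/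
theorem isSuccinctHittingSet_prodAffine {n : ℕ} (hn : 8 ≤ n) :
    IsSuccinctHittingSet (degLEMonomials n) (SmallCircuits ℂ n 9)
      {D | ∃ (p : ℕ) (a : ℂ) (ℓ : Fin p → MvPolynomial (degLEMonomials n) ℂ),
        (∀ i, (ℓ i).totalDegree = 1) ∧ D = C a * ∏ i, ℓ i} := by
  rintro D ⟨p, a, ℓ, hℓ, rfl⟩ hD0
  refine isSuccinctHittingSet_sps2 hn _ ⟨p, 0, a, 0, ℓ, Fin.elim0, hℓ, fun j => j.elim0, ?_⟩ hD0
  simp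

/-- **`2 × 2` determinants of affine forms are hit**: for `n ≥ 8`, `SmallCircuits ℂ n 9` hits every
nonzero `ℓ₁ ℓ₂ - ℓ₃ ℓ₄` with non-constant affine forms `ℓ_k` of the coefficient variables (the
Plücker-type quadrics in affine forms; `p = q = 2`, `a = 1`, `b = -1`).
[cite: ForbesShpilkaVolk2018, Question 6] -/
theorem isSuccinctHittingSet_twoByTwoAffine {n : ℕ} (hn : 8 ≤ n) :
    IsSuccinctHittingSet (degLEMonomials n) (SmallCircuits ℂ n 9)
      {D | ∃ ℓ₁ ℓ₂ ℓ₃ ℓ₄ : MvPolynomial (degLEMonomials n) ℂ,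
        ℓ₁.totalDegree = 1 ∧ ℓ₂.totalDegree = 1 ∧ ℓ₃.totalDegree = 1 ∧ ℓ₄.totalDegree = 1 ∧
        D = ℓ₁ * ℓ₂ - ℓ₃ * ℓ₄} := by
  rintro D ⟨ℓ₁, ℓ₂, ℓ₃, ℓ₄, h₁, h₂, h₃, h₄, rfl⟩ hD0
  refine isSuccinctHittingSet_sps2 hn _
    ⟨2, 2, 1, -1, ![ℓ₁, ℓ₂], ![ℓ₃, ℓ₄], ?_, ?_, ?_⟩ hD0
  · intro i; fin_cases i <;> assumption
  · intro j; fin_cases j <;> assumption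
  · simp only [Fin.prod_univ_two, Matrix.cons_val_zero, Matrix.cons_val_one, map_one,
      one_mul, map_neg, neg_mul, Matrix.cons_val_fin_one]
    ring

end Summit.ValiantsHypothesis.ValiantsHypothesis.Theorems.BarrierLever.SuccinctHittingSetsForVP
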